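import Summits.CriticalPhenomena.SAWScalingLimit.Theorems.SAWRenewalTightnessEventualTightBulkOfVirginArc
import Summits.CriticalPhenomena.SAWScalingLimit.Theorems.SAWRenewalTightnessEventualTightSplit

/-!
# `EventualTight`, line `Sketch` v7: the crux modulo its two research leaves, as ONE theorem

Crux stmt-CriticalPhenomena-1372 (`SAWRenewalTightness.EventualTight`), line `Sketch`, registration v7 (lead c4).  The end state of
the line, composed from landed files only:

* (`bulkShellTight_of_virginArcTraversalTight`, file `…BulkOfVirginArc.lean`: the virgin-arc count atom X2c₁ gives the bulk child
  `BulkShellTight`, stmt-17588 — virginization then aspect reduction);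
* `eventualTight_of_virginArcTraversalTight_of_confinementPositivity` — X2c₁ and restriction positivity E
  (`stub_confinementPositivity` = the child `ConfinementPositivity`, stmt-17587; verbatim) give the crux, through the split glue
  `EventualTight_of_subs` (file `…Split.lean`).

So `EventualTight ⟸ E ∧ X2c₁` with E summit-implied (p105757) and X2c₁ a pure lattice statement (finite discs of `ℤ²`, two doors,
arbitrary exterior; `Cruxes/EventualTight/LeadAnalysis-c4.md` §2, numerics `X2c-attack-c4.md`).  Both hypotheses are research-grade and
are NOT asserted here. [cite: AizenmanBurchardDuke1999, Thm 1.1] [cite: DuminilCopinSmirnov2012, §2]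
-/

noncomputable section

open MeasureTheory Filter Topology Set Metric
open scoped ENNReal NNReal unitInterval
open Literature.Probability.RandomPlanarGeometry Literature.Probability.LatticeModels

namespace Summit.CriticalPhenomena.SAWScalingLimit.Theorems

/-- **The crux modulo its two research leaves**: X2c₁ (`stub_virginArcTraversalTight`) and restriction positivity E
(`stub_confinementPositivity` = `ConfinementPositivity`, stmt-17587) imply `EventualTight` (stmt-1372), through the split glue
`EventualTight_of_subs`. [folklore] -/
theorem eventualTight_of_virginArcTraversalTight_of_confinementPositivity :
    (∀ θ : ℝ, 0 < θ →
      ∃ (k : ℕ) (N₀ : ℝ), 0 < N₀ ∧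
        ∀ (H : SimpleGraph (Site 2)) (Λ : Set (Site 2)) (z₀ : ℂ) (N : ℝ) (u c u' c' : Site 2),
          N₀ ≤ N →
          (H ≤ zdGraph 2 ∧ (∀ v : Site 2, dist (Site.toComplex v) z₀ ≤ N → v ∈ Λ) ∧
            ∀ v v' : Site 2, dist (Site.toComplex v) z₀ ≤ N + 1 →
              dist (Site.toComplex v') z₀ ≤ N + 1 → (zdGraph 2).Adj v v' → H.Adj v v') →
          (H.Adj u c ∧ u ∉ Λ ∧ c ∈ Λ ∧ dist (Site.toComplex c) z₀ ≤ N ∧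
            N < dist (Site.toComplex u) z₀) →
          (H.Adj u' c' ∧ u' ∉ Λ ∧ c' ∈ Λ ∧ dist (Site.toComplex c') z₀ ≤ N ∧
            N < dist (Site.toComplex u') z₀) →
          ∑' p : {p : {p : H.Walk c c' // p.IsPath ∧ ∀ v ∈ p.support, v ∈ Λ} //
              ∃ ι κ : Fin k → Fin (p.1.support.map Site.toComplex).length, (∀ m, ι m ≤ κ m) ∧
                (∀ m, (dist ((p.1.support.map Site.toComplex).get (ι m)) z₀ ≤ 2 * N / 5 ∧
                    3 * N / 5 ≤ dist ((p.1.support.map Site.toComplex).get (κ m)) z₀) ∨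
                  (3 * N / 5 ≤ dist ((p.1.support.map Site.toComplex).get (ι m)) z₀ ∧
                    dist ((p.1.support.map Site.toComplex).get (κ m)) z₀ ≤ 2 * N / 5)) ∧
                ∀ ⦃m m'⦄, m < m' → κ m ≤ ι m'},
              ENNReal.ofReal (SAW.criticalFugacity ^ p.1.1.length) ≤
            ENNReal.ofReal θ *
              ∑' p : {p : H.Walk c c' // p.IsPath ∧ ∀ v ∈ p.support, v ∈ Λ},
                ENNReal.ofReal (SAW.criticalFugacity ^ p.1.length)) →
    (∀ (D D' : DobrushinDomain) (a b : ℝ → Site 2) (d : ℝ), 0 < d →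
      D'.carrier ⊆ D.carrier → D'.pt 0 = D.pt 0 → D'.pt 1 = D.pt 1 →
      D.carrier ∩ (Metric.ball (D.pt 0) d ∪ Metric.ball (D.pt 1) d) ⊆ D'.carrier →
      SAW.IsEndpointApprox D' a b →
        ∃ c δ₀ : ℝ, 0 < c ∧ 0 < δ₀ ∧ ∀ δ ∈ Set.Ioc (0 : ℝ) δ₀,
          ENNReal.ofReal c ≤ SAW.law D.carrier δ (a δ) (b δ)
            {γ | ∃ γ' : SAW.DomainSAW D'.carrier δ (a δ) (b δ),
              γ'.walk.support = γ.walk.support}) →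
    Summit.CriticalPhenomena.SAWScalingLimit.Theses.SAWRenewalTightness.EventualTight :=
  fun hX hE => EventualTight_of_subs hE (bulkShellTight_of_virginArcTraversalTight hX)

end Summit.CriticalPhenomena.SAWScalingLimit.Theorems

end
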